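import Mathlib

/-!
# FunctionalMining/NoGo — junction algebra of the sharp class, III: SECTOR ANGLES — director closure
# is KAWASAKI's condition; the 4-valent junction lines; the 3-valent exclusion in sector form
# (`SIEVELD.md` §3.4b (8f)(i)), staged by the no-go seat (cell `pub-nsfunc`, nogo gen 23)

Search for candidate a priori estimates; no regularity claim. The planner seat cannot file under
`FunctionalMining/`; this file is STAGED for the prove seat (`pub-nsfunc-nogo/NoGo/STAGING.md`,
filing request #6; pen source `SIEVELD.md` §3.4b (8f)(i) 'common tilt … dimension count … KAWASAKI',
nogo g13–g14). Companions: `FreeJunctionLoopLaw.lean` (I, request #4) and `TiltedJunctionLoopLaw.lean`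
(II, request #5) prove the matrix identities behind the LOOP LAW; this file is `import Mathlib` only,
independent of both, and works purely with ANGLES.

Setting (informal dictionary, as in I/II). Around a junction line of the sharp class, `k` walls are
half-planes through the line, seen in the cross-section as rays at angles `ν 0, ν 1, …, ν (k−1)`; the
in-plane director angle is REFLECTED across each wall, `α (i+1) = 2 ν i − α i` (`dirAngle`), the wall
deviation is `δ i = ν i − α i` (`dev`), and the sector between consecutive walls is `g (i+1) = ν (i+1) − ν i`
(the wrap-around sector `g 0` closes the turn: `Σ g = 2π`). By I/II (`loop_law`, `loop_law3`,
`well_eq_well_iff`, `K3_eq_K3_iff`) a configuration is a junction line of the model iff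
(closure) the director closes up — `α k ≡ α 0 (mod 2π)` on a tilted line, `(mod π)` on a free one — and
(axial loop law) `Σ_{i<k} sin (2 δ i) = 0`. This file analyses these two scalar conditions.

What this file PROVES (real trigonometry only; `[ours, elementary]`; the pen statements are (8f)(i)):

* `dev_succ`: `δ (i+1) = g (i+1) − δ i`; `dirAngle_even` / `dirAngle_odd`: after an even number `2j` of
  walls the director has turned by twice the ODD-SECTOR SUM `S_j = g₁ + g₃ + ⋯ + g_{2j−1}`
  (`oddSectorSum`); after an odd number it is reflected.
* `closure_even_iff`, `kawasaki`, `kawasaki_of_ordered`: for EVEN valence `k = 2j` the director closes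
  up mod `2π` iff `S_j ≡ 0 (mod π)`, i.e. — for rays in cyclic order within one turn, where
  `0 < S_j < 2π` (`oddSectorSum_pos`, `oddSectorSum_succ_le`) — iff `S_j = π = Σ g − S_j`: the alternating
  sum of the sector angles vanishes. This is exactly KAWASAKI's (Kawasaki–Justin) flat-foldability
  condition for a single origami vertex (name only; Hull, arXiv:1307.1065; Handbook of Discrete and
  Computational Geometry 2005 p. 186) — (8f)(i): 'closure ⟺ the KAWASAKI condition g₀ + g₂ = g₁ + g₃ = π'.
  `closure_even_free_iff`, `kawasaki_free`: on a FREE line (closure mod `π`) `S_j ∈ {π/2, π, 3π/2}`: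
  the Kawasaki class plus the 'antipodal' class with alternating sum `±π` ((8f)(i): 'at s = 0 a second,
  antipodal class … exists, which admits no tilting'; the explicit 4-valent junction of file II has
  sectors `135°, 45°, 135°, 45°`, `S = 90°`: antipodal). `closure_odd_iff`: for ODD valence closure
  mod `2π` holds iff `α 0 ≡ ν (2j) − S_j (mod π)` — it fixes the director instead of constraining sectors.
* `axial_sum_four`, `four_valent_axial_iff`, `four_valent_classification`: on the 4-valent Kawasaki
  family (`g₁ + g₃ = π`) the axial sum FACTORISES,
  `Σ_{i<4} sin 2δ_i = 4 sin g₁ · sin g₂ · sin (2δ₀ + g₂ − g₁)`, so for non-degenerate sectors the loop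
  law holds iff `2δ₀ ≡ g₁ − g₂ (mod π)` — (8f)(i): '4-valent junction lines form a 2-parameter family at
  every tilt … the axial law ⟺ 2δ₀ ≡ g₁ − g₂ (mod π)'; `no_X_junction`: two crossing planes with two
  alternating directors (the X; necessarily perpendicular) never satisfy the loop law non-degenerately.
* `three_valent_dev_of_closure`, `three_valent_axial_sum`, `no_threeValent_junction_sectors`,
  `threeValent_halfplane_sector`: for `k = 3`, closure (mod `π`, covering every tilt) forces
  `δ₀ ≡ −g₂ (mod π/2)` and then `Σ_{i<3} sin 2δ_i = ± 4 sin g₀ sin g₁ sin g₂`; so the loop law forces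
  `sin g_i = 0` for some sector, i.e. (rays in cyclic order) SOME SECTOR IS A HALF-PLANE `g_i = π` —
  the two walls bounding it are one plane and the junction is not a genuine 3-valent line. This is the
  sector form of (8f)(i) 'THEOREM (no 3-valent junction lines, any tilt)' / (8a)(iv) / (7b)(R5); the
  `δ`-forms are `Junction.no_threeValent_free_junction` (I),
  `TiltedJunction.no_threeValent_junction_closure_two_pi` (II) and the tree's
  `E2.TheoremSCore.no_three_valent_vertex`.

Nothing here is a statement about Navier–Stokes. Second implementation of every identity: pure-python
`pub-nsfunc-nogo/sieveld/junction/check_kawasaki_num.py` (residuals ≤ 1.3e-14 over 2·10⁴ samples;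
Kawasaki sampling for `k = 4, 6, 8`).
-/

noncomputable section

namespace Summit.NavierStokesRegularity.FunctionalMining.SharpClass.JunctionSectors

open Real Finset

/-! ## 1. The reflection recursion in angle form -/

/-- Director angle after `i` wall reflections: `α 0 = α₀`, `α (i+1) = 2 ν i − α i` (reflection of the
director across the wall ray at angle `ν i`). -/
def dirAngle (ν : ℕ → ℝ) (α₀ : ℝ) : ℕ → ℝ
  | 0 => α₀
  | i + 1 => 2 * ν i - dirAngle ν α₀ i

/-- Deviation of wall `i`: `δ i = ν i − α i` (the wall at `ν i` takes the director `ν i − δ i` to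
`ν i + δ i`). -/
def dev (ν : ℕ → ℝ) (α₀ : ℝ) (i : ℕ) : ℝ := ν i - dirAngle ν α₀ i

/-- Odd-sector sum `S_j = Σ_{i<j} (ν (2i+1) − ν (2i)) = g₁ + g₃ + ⋯ + g_{2j−1}`. -/
def oddSectorSum (ν : ℕ → ℝ) (j : ℕ) : ℝ := ∑ i ∈ range j, (ν (2 * i + 1) - ν (2 * i))

variable (ν : ℕ → ℝ) (α₀ : ℝ)

/-- `α 0 = α₀`. -/
@[simp] theorem dirAngle_zero : dirAngle ν α₀ 0 = α₀ := rfl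

/-- `α (i+1) = 2 ν i − α i`. -/
theorem dirAngle_succ (i : ℕ) : dirAngle ν α₀ (i + 1) = 2 * ν i - dirAngle ν α₀ i := rfl

/-- Reflection law in the form used by files I/II: `α (i+1) = α i + 2 δ i`. -/
theorem dirAngle_succ' (i : ℕ) : dirAngle ν α₀ (i + 1) = dirAngle ν α₀ i + 2 * dev ν α₀ i := by
  simp only [dirAngle_succ, dev]; ring

/-- **Deviation recursion** `δ (i+1) = g (i+1) − δ i` with `g (i+1) = ν (i+1) − ν i` ((8f)(i)). -/
theorem dev_succ (i : ℕ) : dev ν α₀ (i + 1) = (ν (i + 1) - ν i) - dev ν α₀ i := by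
  simp only [dev, dirAngle_succ]; ring

/-- `S_0 = 0`. -/
@[simp] theorem oddSectorSum_zero : oddSectorSum ν 0 = 0 := by simp [oddSectorSum]

/-- `S_{j+1} = S_j + g_{2j+1}`. -/
theorem oddSectorSum_succ (j : ℕ) :
    oddSectorSum ν (j + 1) = oddSectorSum ν j + (ν (2 * j + 1) - ν (2 * j)) := by
  unfold oddSectorSum; rw [sum_range_succ]

/-- After an even number of walls the director has turned by `2 S_j`: `α (2j) = α₀ + 2 S_j`. -/
theorem dirAngle_even (j : ℕ) : dirAngle ν α₀ (2 * j) = α₀ + 2 * oddSectorSum ν j := by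
  induction j with
  | zero => simp
  | succ j ih =>
    have e : 2 * (j + 1) = (2 * j + 1) + 1 := by ring
    rw [e, dirAngle_succ, dirAngle_succ, ih, oddSectorSum_succ]; ring

/-- After an odd number of walls the director is reflected: `α (2j+1) = 2 ν (2j) − α₀ − 2 S_j`. -/
theorem dirAngle_odd (j : ℕ) :
    dirAngle ν α₀ (2 * j + 1) = 2 * ν (2 * j) - α₀ - 2 * oddSectorSum ν j := by
  rw [dirAngle_succ, dirAngle_even]; ring

/-! ## 2. Director closure: KAWASAKI's condition -/

/-- **Even valence, tilted line.** The director closes up mod `2π` after `2j` walls iff the odd-sector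
sum is a multiple of `π`. -/
theorem closure_even_iff (j : ℕ) :
    (∃ m : ℤ, dirAngle ν α₀ (2 * j) = α₀ + m * (2 * π)) ↔ ∃ m : ℤ, oddSectorSum ν j = m * π := by
  rw [dirAngle_even]
  constructor <;> rintro ⟨m, hm⟩ <;> exact ⟨m, by linarith⟩

/-- **Even valence, free line** (`s = 0`: directors are defined mod `π`). Closure mod `π` iff the
odd-sector sum is a multiple of `π/2`. -/
theorem closure_even_free_iff (j : ℕ) :
    (∃ m : ℤ, dirAngle ν α₀ (2 * j) = α₀ + m * π) ↔ ∃ m : ℤ, oddSectorSum ν j = m * (π / 2) := by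
  rw [dirAngle_even]
  constructor <;> rintro ⟨m, hm⟩ <;> exact ⟨m, by linarith⟩

/-- **Odd valence.** Closure mod `2π` after `2j+1` walls does not constrain the sectors: it holds iff
the initial director is `α₀ ≡ ν (2j) − S_j (mod π)` ((8f)(i): 'k odd: α₀ determined mod π'). -/
theorem closure_odd_iff (j : ℕ) :
    (∃ m : ℤ, dirAngle ν α₀ (2 * j + 1) = α₀ + m * (2 * π)) ↔
      ∃ m : ℤ, α₀ = ν (2 * j) - oddSectorSum ν j + m * π := by
  rw [dirAngle_odd]
  constructor
  · rintro ⟨m, hm⟩; exact ⟨-m, by push_cast; linarith⟩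
  · rintro ⟨m, hm⟩; exact ⟨-m, by push_cast; linarith⟩

/-- A multiple of `π` strictly between `0` and `2π` is `π`. -/
theorem eq_pi_of_eq_int_mul_pi (S : ℝ) (m : ℤ) (h0 : 0 < S) (h1 : S < 2 * π) (h : S = m * π) :
    S = π := by
  have hm0 : (0 : ℝ) < m := by
    by_contra hc; rw [not_lt] at hc; nlinarith [pi_pos]
  have hm2 : (m : ℝ) < 2 := by
    by_contra hc; rw [not_lt] at hc; nlinarith [pi_pos]
  have hm : m = 1 := by
    have a : (0 : ℤ) < m := by exact_mod_cast hm0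
    have b : m < (2 : ℤ) := by exact_mod_cast hm2
    omega
  rw [h, hm]; simp

/-- **KAWASAKI's condition** (pinned form). If the odd-sector sum lies in `(0, 2π)` — automatic for rays
in cyclic order within one turn (`kawasaki_of_ordered`) — then the director closes up mod `2π` after
the `2j` walls iff `S_j = π`; since all `2j` sectors sum to `2π`, equivalently the even-sector sum is
`π` too, i.e. the ALTERNATING SUM of the sector angles VANISHES (flat-foldability of a degree-`2j`
origami vertex; for `k = 4`: `g₀ + g₂ = g₁ + g₃ = π`). -/
theorem kawasaki (j : ℕ) (h0 : 0 < oddSectorSum ν j) (h1 : oddSectorSum ν j < 2 * π) :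
    (∃ m : ℤ, dirAngle ν α₀ (2 * j) = α₀ + m * (2 * π)) ↔ oddSectorSum ν j = π := by
  rw [closure_even_iff]
  constructor
  · rintro ⟨m, hm⟩; exact eq_pi_of_eq_int_mul_pi _ m h0 h1 hm
  · intro h; exact ⟨1, by rw [h]; simp⟩

/-- **Free line: the two closure classes.** With `0 < S_j < 2π`, closure mod `π` holds iff
`S_j = π` (Kawasaki class — these junctions also exist tilted) or `S_j = π/2 ∨ S_j = 3π/2` (the
antipodal class, alternating sector sum `±π`, which exists only at tilt `s = 0`). -/
theorem kawasaki_free (j : ℕ) (h0 : 0 < oddSectorSum ν j) (h1 : oddSectorSum ν j < 2 * π) :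
    (∃ m : ℤ, dirAngle ν α₀ (2 * j) = α₀ + m * π) ↔
      oddSectorSum ν j = π ∨ oddSectorSum ν j = π / 2 ∨ oddSectorSum ν j = 3 * π / 2 := by
  rw [closure_even_free_iff]
  constructor
  · rintro ⟨m, hm⟩
    have hm0 : (0 : ℝ) < m := by
      by_contra hc; rw [not_lt] at hc; nlinarith [pi_pos]
    have hm4 : (m : ℝ) < 4 := by
      by_contra hc; rw [not_lt] at hc; nlinarith [pi_pos]
    have a : (0 : ℤ) < m := by exact_mod_cast hm0
    have b : m < (4 : ℤ) := by exact_mod_cast hm4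
    have hm : m = 1 ∨ m = 2 ∨ m = 3 := by omega
    rcases hm with rfl | rfl | rfl
    · right; left; rw [hm]; simp
    · left; rw [hm]; push_cast; ring
    · right; right; rw [hm]; push_cast; ring
  · rintro (h | h | h)
    · exact ⟨2, by rw [h]; push_cast; ring⟩
    · exact ⟨1, by rw [h]; simp⟩
    · exact ⟨3, by rw [h]; push_cast; ring⟩

/-- The odd-sector sum of rays with non-degenerate odd sectors is positive. -/
theorem oddSectorSum_pos (j : ℕ) (hj : 0 < j) (h : ∀ i, i < j → ν (2 * i) < ν (2 * i + 1)) :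
    0 < oddSectorSum ν j := by
  unfold oddSectorSum
  apply sum_pos
  · intro i hi; rw [mem_range] at hi; linarith [h i hi]
  · exact nonempty_range_iff.mpr (by omega)

/-- For rays listed in non-decreasing order, `S_{j+1} ≤ ν (2j+1) − ν 0` (the odd sectors are some of
the sectors between the first and the last ray). -/
theorem oddSectorSum_succ_le (hmono : Monotone ν) (j : ℕ) :
    oddSectorSum ν (j + 1) ≤ ν (2 * j + 1) - ν 0 := by
  induction j with
  | zero => simp [oddSectorSum]
  | succ j ih =>
    rw [oddSectorSum_succ]
    have h := hmono (show 2 * j + 1 ≤ 2 * (j + 1) by omega)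
    have e : 2 * (j + 1) + 1 = 2 * (j + 1) + 1 := rfl
    linarith

/-- **KAWASAKI's condition, geometric form.** `2(j+1)` wall rays at angles
`ν 0 ≤ ν 1 ≤ ⋯ ≤ ν (2j+1) < ν 0 + 2π` (cyclic order within one turn; `Monotone ν` — extend `ν`
constantly beyond the last ray) with non-degenerate odd sectors: the director closes up mod `2π` iff
the odd-sector sum — equivalently the even-sector sum, including the wrap-around sector
`ν 0 + 2π − ν (2j+1)` — equals `π`. -/
theorem kawasaki_of_ordered (j : ℕ) (hmono : Monotone ν)
    (hodd : ∀ i, i < j + 1 → ν (2 * i) < ν (2 * i + 1)) (hturn : ν (2 * j + 1) < ν 0 + 2 * π) :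
    (∃ m : ℤ, dirAngle ν α₀ (2 * (j + 1)) = α₀ + m * (2 * π)) ↔ oddSectorSum ν (j + 1) = π :=
  kawasaki ν α₀ (j + 1) (oddSectorSum_pos ν (j + 1) (by omega) hodd)
    (by linarith [oddSectorSum_succ_le ν hmono j])

/-! ## 3. The 4-valent junction lines: a 2-parameter family at every tilt -/

/-- `sin (x+a−b) + sin (a+b−x) + sin (x+b−a) − sin (x+a+b) = 4 sin a · sin b · sin x`. -/
theorem sin_four_term (x a b : ℝ) :
    sin (x + a - b) + sin (a + b - x) + sin (x + b - a) - sin (x + a + b) =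
      4 * sin a * sin b * sin x := by
  simp only [sin_add, sin_sub, cos_add]; ring

/-- **Axial sum on the 4-valent Kawasaki family** ((8f)(i)). With `δ_{i+1} = g_{i+1} − δ_i` and
`g₁ + g₃ = π`: `Σ_{i<4} sin 2δ_i = 4 sin g₁ · sin g₂ · sin (2δ₀ + g₂ − g₁)`. -/
theorem axial_sum_four (g₁ g₂ g₃ δ₀ δ₁ δ₂ δ₃ : ℝ) (h₁ : δ₁ = g₁ - δ₀) (h₂ : δ₂ = g₂ - δ₁)
    (h₃ : δ₃ = g₃ - δ₂) (hK : g₁ + g₃ = π) :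
    sin (2 * δ₀) + sin (2 * δ₁) + sin (2 * δ₂) + sin (2 * δ₃) =
      4 * sin g₁ * sin g₂ * sin (2 * δ₀ + g₂ - g₁) := by
  have H := sin_four_term (2 * δ₀ + g₂ - g₁) g₁ g₂
  have a1 : 2 * δ₀ + g₂ - g₁ + g₁ - g₂ = 2 * δ₀ := by ring
  have a2 : g₁ + g₂ - (2 * δ₀ + g₂ - g₁) = 2 * δ₁ := by rw [h₁]; ring
  have a3 : 2 * δ₀ + g₂ - g₁ + g₂ - g₁ = 2 * δ₂ := by rw [h₂, h₁]; ring
  have a4 : sin (2 * δ₀ + g₂ - g₁ + g₁ + g₂) = -sin (2 * δ₃) := by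
    have e : 2 * δ₃ = 2 * π - (2 * δ₀ + g₂ - g₁ + g₁ + g₂) := by rw [h₃, h₂, h₁]; linarith
    rw [e, sin_two_pi_sub]; ring
  rw [a1, a2, a3, a4] at H
  linarith

/-- **Classification of the 4-valent axial law** ((8f)(i)). On the Kawasaki family with non-degenerate
sectors `sin g₁ ≠ 0`, `sin g₂ ≠ 0`, the loop law `Σ_{i<4} sin 2δ_i = 0` holds iff
`2δ₀ ≡ g₁ − g₂ (mod π)`: together with `kawasaki` the 4-valent junction lines are the 2-parameter
family `(g₁, g₂)` — `g₃ = π − g₁`, `g₀ = π − g₂`, `δ₀ ≡ (g₁ − g₂)/2 (mod π/2)` — at every tilt. -/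
theorem four_valent_axial_iff (g₁ g₂ g₃ δ₀ δ₁ δ₂ δ₃ : ℝ) (h₁ : δ₁ = g₁ - δ₀) (h₂ : δ₂ = g₂ - δ₁)
    (h₃ : δ₃ = g₃ - δ₂) (hK : g₁ + g₃ = π) (hg₁ : sin g₁ ≠ 0) (hg₂ : sin g₂ ≠ 0) :
    sin (2 * δ₀) + sin (2 * δ₁) + sin (2 * δ₂) + sin (2 * δ₃) = 0 ↔
      ∃ m : ℤ, 2 * δ₀ = g₁ - g₂ + m * π := by
  rw [axial_sum_four g₁ g₂ g₃ δ₀ δ₁ δ₂ δ₃ h₁ h₂ h₃ hK, mul_eq_zero, mul_eq_zero, mul_eq_zero]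
  have h4 : (4 : ℝ) ≠ 0 := by norm_num
  simp only [h4, hg₁, hg₂, or_false, false_or]
  rw [sin_eq_zero_iff]
  constructor <;> rintro ⟨m, hm⟩ <;> exact ⟨m, by linarith⟩

/-- `S_2 = (ν 1 − ν 0) + (ν 3 − ν 2) = g₁ + g₃`. -/
theorem oddSectorSum_two : oddSectorSum ν 2 = (ν 1 - ν 0) + (ν 3 - ν 2) := by
  rw [show (2 : ℕ) = 0 + 1 + 1 from rfl, oddSectorSum_succ, oddSectorSum_succ, oddSectorSum_zero]; ring

/-- 4-valent closure (tilted line): `α 4 ≡ α₀ (mod 2π)` iff `g₁ + g₃ ≡ 0 (mod π)`. -/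
theorem four_valent_closure_iff :
    (∃ m : ℤ, dirAngle ν α₀ 4 = α₀ + m * (2 * π)) ↔ ∃ m : ℤ, (ν 1 - ν 0) + (ν 3 - ν 2) = m * π := by
  rw [← oddSectorSum_two, ← closure_even_iff ν α₀ 2]

/-- **The 4-valent junction lines, recursion form.** Four wall rays with the Kawasaki condition
`g₁ + g₃ = π` and non-degenerate sectors `g₁, g₂`: the axial loop law `Σ_{i<4} sin (2 δ i) = 0` holds
iff `2 δ 0 ≡ g₁ − g₂ (mod π)` ((8f)(i); checked there on all 99 tilted `k = 4` solver rows of j106921). -/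
theorem four_valent_classification (hK : (ν 1 - ν 0) + (ν 3 - ν 2) = π)
    (hg₁ : sin (ν 1 - ν 0) ≠ 0) (hg₂ : sin (ν 2 - ν 1) ≠ 0) :
    ∑ i ∈ range 4, sin (2 * dev ν α₀ i) = 0 ↔
      ∃ m : ℤ, 2 * dev ν α₀ 0 = (ν 1 - ν 0) - (ν 2 - ν 1) + m * π := by
  have h := four_valent_axial_iff (ν 1 - ν 0) (ν 2 - ν 1) (ν 3 - ν 2) (dev ν α₀ 0) (dev ν α₀ 1)
    (dev ν α₀ 2) (dev ν α₀ 3) (dev_succ ν α₀ 0) (dev_succ ν α₀ 1) (dev_succ ν α₀ 2) hK hg₁ hg₂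
  simpa [sum_range_succ, add_assoc] using h

/-- **The X configuration is not a junction line** ((8f)(T1): 'the two-well X … violates the loop
law'). Two crossing planes carrying two alternating directors must be PERPENDICULAR (their normals are
`∥ n − n'` and `∥ n + n'`), so all four sectors are `π/2` and Kawasaki holds; but then the axial loop
law forces `sin (2 δ 0) = 0` — wall `0` does not change the director line: no X junction at any tilt. -/
theorem no_X_junction (h1 : ν 1 - ν 0 = π / 2) (h2 : ν 2 - ν 1 = π / 2) (h3 : ν 3 - ν 2 = π / 2)
    (hloop : ∑ i ∈ range 4, sin (2 * dev ν α₀ i) = 0) : sin (2 * dev ν α₀ 0) = 0 := by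
  have S := axial_sum_four (ν 1 - ν 0) (ν 2 - ν 1) (ν 3 - ν 2) (dev ν α₀ 0) (dev ν α₀ 1) (dev ν α₀ 2)
    (dev ν α₀ 3) (dev_succ ν α₀ 0) (dev_succ ν α₀ 1) (dev_succ ν α₀ 2) (by rw [h1, h3]; ring)
  have hsum : ∑ i ∈ range 4, sin (2 * dev ν α₀ i) =
      sin (2 * dev ν α₀ 0) + sin (2 * dev ν α₀ 1) + sin (2 * dev ν α₀ 2) + sin (2 * dev ν α₀ 3) := by
    simp [sum_range_succ, add_assoc]
  rw [hsum, S, h1, h2, add_sub_cancel_right, sin_pi_div_two] at hloop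
  linarith

/-! ## 4. The 3-valent exclusion in sector form -/

/-- `sin 2a + sin 2b − sin (2a+2b) = 4 sin a · sin b · sin (a+b)` (restated from file I and the tree's
`E2.TheoremSCore.sin_two_mul_add_sin_two_mul_sub` to keep this file `Mathlib`-only). -/
theorem sin_add_sin_sub_sin_add (a b : ℝ) :
    sin (2 * a) + sin (2 * b) - sin (2 * a + 2 * b) = 4 * sin a * sin b * sin (a + b) := by
  have e : 2 * a + 2 * b = 2 * (a + b) := by ring
  rw [e, sin_two_mul, sin_two_mul, sin_two_mul, sin_add, cos_add]
  have ha := sin_sq_add_cos_sq a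
  have hb := sin_sq_add_cos_sq b
  linear_combination (-(2 * sin a * cos a)) * hb + (-(2 * sin b * cos b)) * ha

/-- **3-valent closure fixes the first deviation** ((8f)(i): '2δ_i ≡ −2g_{i′}'). For three walls,
closure mod `π` (which covers the tilted closure mod `2π` and the free one) gives
`δ 0 = −g₂ + m·(π/2)` with `g₂ = ν 2 − ν 1` the sector NOT adjacent to wall `0`. -/
theorem three_valent_dev_of_closure (m : ℤ) (hclos : dirAngle ν α₀ 3 = α₀ + m * π) :
    dev ν α₀ 0 = -(ν 2 - ν 1) + m * (π / 2) := by
  simp only [dev, dirAngle] at *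
  linarith

/-- **3-valent axial sum** in sector form: with `δ₀ = −g₂ + m·(π/2)`, `δ₁ = g₁ − δ₀`, `δ₂ = g₂ − δ₁`,
`Σ_{i<3} sin 2δ_i = (−1)^m · 4 sin (2π − g₁ − g₂) · sin g₁ · sin g₂` (`2π − g₁ − g₂ = g₀`, the third
sector). -/
theorem three_valent_axial_sum (g₁ g₂ δ₀ δ₁ δ₂ : ℝ) (m : ℤ) (h₀ : δ₀ = -g₂ + m * (π / 2))
    (h₁ : δ₁ = g₁ - δ₀) (h₂ : δ₂ = g₂ - δ₁) :
    sin (2 * δ₀) + sin (2 * δ₁) + sin (2 * δ₂) =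
      (-1) ^ m * (4 * sin (2 * π - g₁ - g₂) * sin g₁ * sin g₂) := by
  have hg₀ : sin (2 * π - g₁ - g₂) = -sin (g₁ + g₂) := by
    rw [show 2 * π - g₁ - g₂ = 2 * π - (g₁ + g₂) by ring, sin_two_pi_sub]
  have F := sin_add_sin_sub_sin_add g₁ g₂
  rcases Int.even_or_odd m with ⟨n, rfl⟩ | ⟨n, rfl⟩
  · -- `m = 2n`: `2δ₀ = −2g₂ + n·2π`
    have e₀ : 2 * δ₀ = -(2 * g₂) + n * (2 * π) := by rw [h₀]; push_cast; ring
    have e₁ : 2 * δ₁ = (2 * g₁ + 2 * g₂) - n * (2 * π) := by rw [h₁, h₀]; push_cast; ring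
    have e₂ : 2 * δ₂ = -(2 * g₁) + n * (2 * π) := by rw [h₂, h₁, h₀]; push_cast; ring
    have hp : ((-1 : ℝ)) ^ (n + n) = 1 := Even.neg_one_zpow ⟨n, rfl⟩
    rw [e₀, e₁, e₂, sin_add_int_mul_two_pi, sin_sub_int_mul_two_pi, sin_add_int_mul_two_pi, sin_neg,
      sin_neg, hp, hg₀]
    linarith
  · -- `m = 2n+1`: `2δ₀ = (π − 2g₂) + n·2π`
    have e₀ : 2 * δ₀ = (π - 2 * g₂) + n * (2 * π) := by rw [h₀]; push_cast; ring
    have e₁ : 2 * δ₁ = ((2 * g₁ + 2 * g₂) - π) - n * (2 * π) := by rw [h₁, h₀]; push_cast; ring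
    have e₂ : 2 * δ₂ = (π - 2 * g₁) + n * (2 * π) := by rw [h₂, h₁, h₀]; push_cast; ring
    have hp : ((-1 : ℝ)) ^ (2 * n + 1) = -1 := Odd.neg_one_zpow ⟨n, rfl⟩
    rw [e₀, e₁, e₂, sin_add_int_mul_two_pi, sin_sub_int_mul_two_pi, sin_add_int_mul_two_pi, sin_pi_sub,
      sin_pi_sub, sin_sub_pi, hp, hg₀]
    linarith

/-- **No 3-valent junction line, sector form** ((8f)(i) THEOREM; (8a)(iv); (7b)(R5)). Three walls with
closure mod `π` (any tilt) and the axial loop law have a sector with `sin g_i = 0`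
(`g₁ = ν 1 − ν 0`, `g₂ = ν 2 − ν 1`, `g₀ = ν 0 + 2π − ν 2`). -/
theorem no_threeValent_junction_sectors (m : ℤ) (hclos : dirAngle ν α₀ 3 = α₀ + m * π)
    (hloop : ∑ i ∈ range 3, sin (2 * dev ν α₀ i) = 0) :
    sin (ν 0 + 2 * π - ν 2) = 0 ∨ sin (ν 1 - ν 0) = 0 ∨ sin (ν 2 - ν 1) = 0 := by
  have h₀ := three_valent_dev_of_closure ν α₀ m hclos
  have S := three_valent_axial_sum (ν 1 - ν 0) (ν 2 - ν 1) (dev ν α₀ 0) (dev ν α₀ 1) (dev ν α₀ 2) m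
    h₀ (dev_succ ν α₀ 0) (dev_succ ν α₀ 1)
  have hsum : ∑ i ∈ range 3, sin (2 * dev ν α₀ i) =
      sin (2 * dev ν α₀ 0) + sin (2 * dev ν α₀ 1) + sin (2 * dev ν α₀ 2) := by
    simp [sum_range_succ, add_assoc]
  rw [hsum, S] at hloop
  have hu : ((-1 : ℝ)) ^ m ≠ 0 := zpow_ne_zero m (by norm_num)
  have e : 2 * π - (ν 1 - ν 0) - (ν 2 - ν 1) = ν 0 + 2 * π - ν 2 := by ring
  rw [e] at hloop
  rcases mul_eq_zero.mp hloop with h | h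
  · exact absurd h hu
  · rcases mul_eq_zero.mp h with h | h
    · rcases mul_eq_zero.mp h with h | h
      · rcases mul_eq_zero.mp h with h | h
        · norm_num at h
        · left; exact h
      · right; left; exact h
    · right; right; exact h

/-- An angle strictly between `0` and `2π` with vanishing sine is `π`. -/
theorem eq_pi_of_sin_eq_zero (g : ℝ) (h0 : 0 < g) (h1 : g < 2 * π) (h : sin g = 0) : g = π := by
  have hs : sin (g - π) = 0 := by rw [sin_sub_pi, h, neg_zero]
  have := (sin_eq_zero_iff_of_lt_of_lt (by linarith) (by linarith)).mp hs
  linarith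

/-- **Geometric conclusion.** Three wall rays in cyclic order within one turn
(`ν 0 < ν 1 < ν 2 < ν 0 + 2π`), closure mod `π` and the loop law: SOME SECTOR IS A HALF-PLANE
(`= π`) — its two bounding walls are one plane, so the configuration is a single wall crossed by a
third ray, not a genuine 3-valent junction line. Junction lines of the model have valence `≥ 4` at
every tilt. -/
theorem threeValent_halfplane_sector (m : ℤ) (h01 : ν 0 < ν 1) (h12 : ν 1 < ν 2)
    (h20 : ν 2 < ν 0 + 2 * π) (hclos : dirAngle ν α₀ 3 = α₀ + m * π)
    (hloop : ∑ i ∈ range 3, sin (2 * dev ν α₀ i) = 0) :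
    ν 0 + 2 * π - ν 2 = π ∨ ν 1 - ν 0 = π ∨ ν 2 - ν 1 = π := by
  rcases no_threeValent_junction_sectors ν α₀ m hclos hloop with h | h | h
  · left; exact eq_pi_of_sin_eq_zero _ (by linarith) (by linarith) h
  · right; left; exact eq_pi_of_sin_eq_zero _ (by linarith) (by linarith) h
  · right; right; exact eq_pi_of_sin_eq_zero _ (by linarith) (by linarith) h

end Summit.NavierStokesRegularity.FunctionalMining.SharpClass.JunctionSectors

end
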